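import Summits.ABC.StewartYu.GenThreeFrameSpecTwoRat
import Summits.ABC.StewartYu.GenThreeEndBridgeTwo
import Mathlib.Algebra.MvPolynomial.Degrees
import HarnessLib

/-!
# Cell abc-stewartyu, A1.L tranche (cruxes r3 `PadicCoreOddRat` / r4 `PadicCoreTwoRat`): `MomentGL` and the END-INPUT BRIDGE for complex units —
# shared output algebra of the two saturated (`𝔑`-threaded) Gen-3 frames

`Summits/ABC/StewartYu/GenThreeEndBridgeReal.lean` — cell `abc-stewartyu` (HOME `run/shared/lean/pub/abc-stewartyu/`, design memos
HOME/p2/memo-07 §1 (L4) / HOME/p3/memo-11 (M4); seat p2-g6, for both parities).  Theorems only, place-free algebra; no named fact.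

* **`DirWeights.sum_mul_prod_pow_eq_zero_of_linear`** (`MomentGL`) — if `Σᵢ wᵢ ∏ₖ Xₖ(i)^{ν′ₖ} = 0` for all `|ν′| ≤ U` and
  `Yⱼ(i) = Σₖ cⱼₖ Xₖ(i)` for FIXED coefficients, then `Σᵢ wᵢ ∏ⱼ Yⱼ(i)^{νⱼ} = 0` for all `|ν| ≤ U` (the monomial `∏ⱼ (Σₖ cⱼₖ Xₖ)^{νⱼ}` is an
  `MvPolynomial` of total degree `≤ |ν|`, expanded along its support).  Use: the saturated frames differentiate along the `b̃`-directions
  `zγ(μ)ₖ` (θ-coordinates, pivot `k₀`) while the END at `ξ = αo^{1/N}` wants the `bo`-directions of the virtual exponents `ν(μ) = μ ᵥ* U`;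
* **`GenThreeEndBridgeReal.frameOutputReal_of_hasseIdentities`** — the Units twin of p3-g5's
  `GenThreeEndBridgeTwo.frameOutputTwo_of_hasseIdentities`: native last-level identities (unknowns `i ∈ I`, `Y₀`-factors `Rᵢ` of degree
  `≤ D₀`, exponent vectors `κᵢ` in the box, rational weights, Hasse derivatives, power directional monomials, monomial values `∏ⱼ ξⱼ^{x κᵢⱼ}`
  at complex units `ξ`, stated in `ℂ`) with one nonzero `κ`-fibre ⇒ `GenThreeFrameSpecTwoRat.FrameOutputReal n ξ b j₀ D₀ S₀ X D`.

WHAT THIS IS NOT: no analytic content; no crux moves.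

References: Yu. V. Nesterenko, LNM 1819 (2003), §5.1 (5.1)–(5.4), (3.25)/(3.30); K. Yu, Acta Math. 211 (2013), (5.4), §6.
-/

noncomputable section

open Finset Polynomial
open Summit.ABC.StewartYu.GenThreeFrameSpecTwoRat (FrameOutputReal)
open scoped Nat

namespace Summit.ABC.StewartYu

/-! ### `MomentGL`: directional moments under a linear change of the direction forms -/

namespace DirWeights

/-- **`MomentGL`.**  If the weighted moments `Σᵢ wᵢ ∏ₖ Xₖ(i)^{ν′ₖ}` vanish for all multi-orders `|ν′| ≤ U`, and each `Yⱼ(i)` is a FIXED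
linear combination `Σₖ cⱼₖ Xₖ(i)`, then the moments `Σᵢ wᵢ ∏ⱼ Yⱼ(i)^{νⱼ}` vanish for all `|ν| ≤ U` (the monomial `∏ⱼ (Σₖ cⱼₖ Xₖ)^{νⱼ}` is a
polynomial in the `Xₖ` of total degree `≤ |ν|`). [cite: Nesterenko2003, §5.1 with (3.25)/(3.30); shape only] -/
theorem sum_mul_prod_pow_eq_zero_of_linear {ι K : Type*} [Field K] (B : Finset ι) (w : ι → K) {n m : ℕ}
    (X : ι → Fin n → K) (Y : ι → Fin m → K) (c : Fin m → Fin n → K)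
    (hY : ∀ i ∈ B, ∀ j, Y i j = ∑ k, c j k * X i k) (U : ℕ)
    (hzero : ∀ t : Fin n → ℕ, ∑ k, t k ≤ U → ∑ i ∈ B, w i * ∏ k, X i k ^ t k = 0) :
    ∀ t : Fin m → ℕ, ∑ j, t j ≤ U → ∑ i ∈ B, w i * ∏ j, Y i j ^ t j = 0 := by
  classical
  intro t ht
  -- the polynomial `P = ∏ⱼ (Σₖ cⱼₖ Xₖ)^{tⱼ}`
  set Lf : Fin m → MvPolynomial (Fin n) K := fun j => ∑ k, MvPolynomial.C (c j k) * MvPolynomial.X k with hLf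
  set P : MvPolynomial (Fin n) K := ∏ j, Lf j ^ t j with hP
  have hLdeg : ∀ j, (Lf j).totalDegree ≤ 1 := by
    intro j
    refine MvPolynomial.totalDegree_finsetSum_le fun k _ => ?_
    refine (MvPolynomial.totalDegree_mul _ _).trans ?_
    rw [MvPolynomial.totalDegree_C, zero_add]
    exact (MvPolynomial.totalDegree_X (R := K) k).le
  have hPdeg : P.totalDegree ≤ U := by
    refine (MvPolynomial.totalDegree_finsetProd _ _).trans (le_trans ?_ ht)
    refine sum_le_sum fun j _ => ?_
    refine (MvPolynomial.totalDegree_pow _ _).trans ?_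
    calc t j * (Lf j).totalDegree ≤ t j * 1 := Nat.mul_le_mul_left _ (hLdeg j)
      _ = t j := mul_one _
  -- its evaluation at `X(i)` is `∏ⱼ Yⱼ(i)^{tⱼ}`
  have heval : ∀ i ∈ B, MvPolynomial.eval (X i) P = ∏ j, Y i j ^ t j := by
    intro i hi
    rw [hP, map_prod]
    refine prod_congr rfl fun j _ => ?_
    rw [map_pow, hY i hi j, hLf]
    simp only [map_sum, map_mul, MvPolynomial.eval_C, MvPolynomial.eval_X]
  -- expand along the support
  have hexp : ∀ i ∈ B, ∏ j, Y i j ^ t j = ∑ d ∈ P.support, P.coeff d * ∏ k, X i k ^ d k := by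
    intro i hi
    rw [← heval i hi, MvPolynomial.eval_eq']
  calc ∑ i ∈ B, w i * ∏ j, Y i j ^ t j = ∑ i ∈ B, w i * ∑ d ∈ P.support, P.coeff d * ∏ k, X i k ^ d k := by
        refine sum_congr rfl fun i hi => ?_; rw [hexp i hi]
    _ = ∑ d ∈ P.support, P.coeff d * ∑ i ∈ B, w i * ∏ k, X i k ^ d k := by
        simp only [mul_sum]
        rw [sum_comm]
        refine sum_congr rfl fun d _ => sum_congr rfl fun i _ => ?_
        ring
    _ = 0 := by
        refine sum_eq_zero fun d hd => ?_
        have hdeg : ∑ k, d k ≤ U := by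
          have h1 := MvPolynomial.le_totalDegree hd
          rw [Finsupp.sum_fintype _ _ (fun _ => rfl)] at h1
          exact h1.trans hPdeg
        rw [hzero (fun k => d k) hdeg, mul_zero]

end DirWeights

/-! ### The END-input bridge for complex units -/

namespace GenThreeEndBridgeReal

variable {n : ℕ}

/-- **END-INPUT BRIDGE, complex units.**  Native last-level identities of a frame — unknowns `i ∈ I` with `Y₀`-factors `Rᵢ` of degree
`≤ D₀`, integer exponent vectors `κᵢ` in the box `D`, rational weights `pᵢ`, Hasse derivatives, POWER directional monomials for the pivot `j₀`,
and the monomial values `∏ⱼ ξⱼ^{x κᵢⱼ}` at independent... (any) complex units `ξ` — with ONE nonzero `κ`-fibre `Σ_{κᵢ = κ₀} pᵢ Rᵢ ≠ 0`, give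
`FrameOutputReal n ξ b j₀ D₀ S₀ X D`. [cite: Nesterenko2003, §5.1 (5.1)–(5.4); shape only] -/
theorem frameOutputReal_of_hasseIdentities {ι : Type*} (I : Finset ι) (R : ι → ℚ[X]) (κ : ι → Fin n → ℤ)
    (p : ι → ℚ) (ξ : Fin n → ℂˣ) (b : Fin n → ℤ) (j₀ : Fin n) (D₀ S₀ X : ℕ) (D : Fin n → ℕ)
    (hR : ∀ i ∈ I, (R i).natDegree ≤ D₀) (hκ : ∀ i ∈ I, ∀ j, |κ i j| ≤ (D j : ℤ))
    (hne : ∃ κ₀, ∑ i ∈ I.filter (fun i => κ i = κ₀), p i • R i ≠ 0)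
    (hN : ∀ x : ℤ, |x| ≤ (((n + 1) * X : ℕ) : ℤ) → ∀ (t : ℕ) (ν : Fin n → ℕ), ν j₀ = 0 →
      t + ∑ k, ν k ≤ (n + 1) * S₀ →
      ∑ i ∈ I, (p i : ℂ) * (((hasseDeriv t (R i)).eval (x : ℚ) : ℚ) : ℂ) *
        (∏ k, (((b j₀ * κ i k - b k * κ i j₀ : ℤ)) : ℂ) ^ ν k) * ∏ j, ((ξ j : ℂ)) ^ (x * κ i j) = 0) :
    FrameOutputReal n ξ b j₀ D₀ S₀ X D := by
  classical
  -- the monomial presentation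
  set I' : Finset (ℕ × (Fin n → ℤ)) := (Finset.range (D₀ + 1)) ×ˢ (I.image κ) with hI'
  set qQ : ℕ × (Fin n → ℤ) → ℚ :=
    fun ak => ∑ i ∈ I.filter (fun i => κ i = ak.2), p i * (R i).coeff ak.1 with hqQ
  set q : ℕ × (Fin n → ℤ) → ℂ := fun ak => ((qQ ak : ℚ) : ℂ) with hq
  -- the nonzero fibre
  obtain ⟨κ₀, hκ₀⟩ := hne
  set Q₀ : ℚ[X] := ∑ i ∈ I.filter (fun i => κ i = κ₀), p i • R i with hQ₀
  have hQ₀deg : Q₀.natDegree ≤ D₀ := by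
    rw [hQ₀]
    refine Polynomial.natDegree_sum_le_of_forall_le (s := I.filter (fun i => κ i = κ₀))
      (fun i => p i • R i) fun i hi => ?_
    exact (Polynomial.natDegree_smul_le _ _).trans (hR i (Finset.mem_filter.mp hi).1)
  set a₀ : ℕ := Q₀.natDegree with ha₀
  have hQa₀ : Q₀.coeff a₀ ≠ 0 := by
    rw [ha₀, Polynomial.coeff_natDegree]; exact Polynomial.leadingCoeff_ne_zero.mpr hκ₀
  have hcoeff : ∀ a, Q₀.coeff a = qQ (a, κ₀) := by
    intro a
    rw [hQ₀, Polynomial.finsetSum_coeff]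
    refine Finset.sum_congr rfl fun i _ => ?_
    rw [Polynomial.coeff_smul, smul_eq_mul]
  -- `κ₀` is attained on `I`
  have hκ₀I : κ₀ ∈ I.image κ := by
    have hnonempty : (I.filter (fun i => κ i = κ₀)).Nonempty := by
      by_contra hempty
      rw [Finset.not_nonempty_iff_eq_empty] at hempty
      apply hκ₀; rw [hQ₀, hempty, Finset.sum_empty]
    obtain ⟨i, hi⟩ := hnonempty
    rw [Finset.mem_filter] at hi
    exact Finset.mem_image.mpr ⟨i, hi.1, hi.2⟩
  refine ⟨I', q, (a₀, κ₀), ?_, ?_, ?_, ?_, ?_⟩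
  · -- `a ≤ D₀`
    intro ak hak
    rw [hI', Finset.mem_product, Finset.mem_range] at hak
    omega
  · -- `|κ j| ≤ D j`
    intro ak hak j
    rw [hI', Finset.mem_product, Finset.mem_image] at hak
    obtain ⟨i, hi, hik⟩ := hak.2
    rw [← hik]; exact hκ i hi j
  · -- `(a₀, κ₀) ∈ I'`
    rw [hI', Finset.mem_product, Finset.mem_range]
    exact ⟨by omega, hκ₀I⟩
  · -- `q (a₀, κ₀) ≠ 0`
    rw [hq]; dsimp only
    rw [← hcoeff a₀]
    exact_mod_cast hQa₀
  · -- the identities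
    intro x hx t ν hν hT
    have hid := hN x hx t ν hν hT
    -- abbreviation for the `κ`-dependent factors (over `ℂ`)
    set F : (Fin n → ℤ) → ℂ := fun κ' =>
      (∏ k, ((b j₀ : ℂ) * (κ' k : ℂ) - (b k : ℂ) * (κ' j₀ : ℂ)) ^ ν k) *
        ∏ j, ((ξ j : ℂ)) ^ (x * κ' j) with hF
    -- Step 1: rewrite the presented sum as a double sum over `range (D₀+1) × image κ`
    have hstep1 : ∑ ak ∈ I', q ak * (((ak.1).descFactorial t : ℕ) : ℂ) * ((x : ℂ) * 1) ^ (ak.1 - t) *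
          (∏ k, ((b j₀ : ℂ) * (ak.2 k : ℂ) - (b k : ℂ) * (ak.2 j₀ : ℂ)) ^ ν k) *
          ∏ j, ((ξ j : ℂ)) ^ (x * ak.2 j) =
        ∑ κ' ∈ I.image κ, F κ' * ∑ a ∈ Finset.range (D₀ + 1),
          q (a, κ') * (((a.descFactorial t : ℕ) : ℂ)) * (x : ℂ) ^ (a - t) := by
      rw [hI', Finset.sum_product_right]
      refine Finset.sum_congr rfl fun κ' _ => ?_
      rw [Finset.mul_sum]
      refine Finset.sum_congr rfl fun a _ => ?_
      rw [mul_one, hF]; ring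
    -- Step 2: each inner sum is `t! · ∑_{i : κ i = κ'} p i · Hasse_t(R i)(x)` (cast)
    have hstep2 : ∀ κ' ∈ I.image κ,
        ∑ a ∈ Finset.range (D₀ + 1), q (a, κ') * (((a.descFactorial t : ℕ) : ℂ)) * (x : ℂ) ^ (a - t) =
          (((t ! : ℕ) : ℚ) * ∑ i ∈ I.filter (fun i => κ i = κ'),
              p i * (hasseDeriv t (R i)).eval (x : ℚ) : ℚ) := by
      intro κ' _
      have hdeg : ∀ i ∈ I.filter (fun i => κ i = κ'), (R i).natDegree < D₀ + 1 := fun i hi =>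
        Nat.lt_succ_of_le (hR i (Finset.mem_filter.mp hi).1)
      have hQ : ∑ a ∈ Finset.range (D₀ + 1), qQ (a, κ') * ((a.descFactorial t : ℕ) : ℚ) * (x : ℚ) ^ (a - t) =
          ((t ! : ℕ) : ℚ) * ∑ i ∈ I.filter (fun i => κ i = κ'), p i * (hasseDeriv t (R i)).eval (x : ℚ) := by
        calc ∑ a ∈ Finset.range (D₀ + 1), qQ (a, κ') * ((a.descFactorial t : ℕ) : ℚ) * (x : ℚ) ^ (a - t)
            = ∑ a ∈ Finset.range (D₀ + 1), ∑ i ∈ I.filter (fun i => κ i = κ'),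
                p i * ((R i).coeff a * ((a.descFactorial t : ℕ) : ℚ) * (x : ℚ) ^ (a - t)) := by
              refine Finset.sum_congr rfl fun a _ => ?_
              rw [hqQ]; dsimp only
              rw [Finset.sum_mul, Finset.sum_mul]
              refine Finset.sum_congr rfl fun i _ => ?_
              ring
          _ = ∑ i ∈ I.filter (fun i => κ i = κ'), p i *
                ∑ a ∈ Finset.range (D₀ + 1), (R i).coeff a * ((a.descFactorial t : ℕ) : ℚ) * (x : ℚ) ^ (a - t) := by
              rw [Finset.sum_comm]
              refine Finset.sum_congr rfl fun i _ => ?_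
              rw [Finset.mul_sum]
          _ = ∑ i ∈ I.filter (fun i => κ i = κ'), p i * (((t ! : ℕ) : ℚ) * (hasseDeriv t (R i)).eval (x : ℚ)) := by
              refine Finset.sum_congr rfl fun i hi => ?_
              rw [GenThreeEndBridgeTwo.sum_coeff_descFactorial_eq (R i) (hdeg i hi) t (x : ℚ)]
          _ = ((t ! : ℕ) : ℚ) * ∑ i ∈ I.filter (fun i => κ i = κ'), p i * (hasseDeriv t (R i)).eval (x : ℚ) := by
              rw [Finset.mul_sum]
              refine Finset.sum_congr rfl fun i _ => ?_
              ring
      have hcast : ∑ a ∈ Finset.range (D₀ + 1), q (a, κ') * (((a.descFactorial t : ℕ) : ℂ)) * (x : ℂ) ^ (a - t) =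
          ((∑ a ∈ Finset.range (D₀ + 1), qQ (a, κ') * ((a.descFactorial t : ℕ) : ℚ) * (x : ℚ) ^ (a - t) : ℚ) : ℂ) := by
        rw [hq]; push_cast; rfl
      rw [hcast, hQ]
    -- Step 3: the native identity, regrouped by fibres of `κ`
    have hfib : ∑ κ' ∈ I.image κ, F κ' * ((((t ! : ℕ) : ℚ) * ∑ i ∈ I.filter (fun i => κ i = κ'),
          p i * (hasseDeriv t (R i)).eval (x : ℚ) : ℚ) : ℂ) =
        ((t ! : ℕ) : ℂ) * ∑ i ∈ I, (p i : ℂ) * (((hasseDeriv t (R i)).eval (x : ℚ) : ℚ) : ℂ) *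
          (∏ k, (((b j₀ * κ i k - b k * κ i j₀ : ℤ)) : ℂ) ^ ν k) * ∏ j, ((ξ j : ℂ)) ^ (x * κ i j) := by
      rw [← Finset.sum_fiberwise_of_maps_to (s := I) (t := I.image κ) (g := κ)
        (fun i hi => Finset.mem_image_of_mem κ hi)]
      push_cast
      rw [Finset.mul_sum]
      refine Finset.sum_congr rfl fun κ' _ => ?_
      rw [Finset.mul_sum, Finset.mul_sum, Finset.mul_sum]
      refine Finset.sum_congr rfl fun i hi => ?_
      have hik : κ i = κ' := (Finset.mem_filter.mp hi).2
      rw [hF, ← hik]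
      ring
    rw [hstep1]
    rw [Finset.sum_congr rfl fun κ' hκ' => by rw [hstep2 κ' hκ']]
    rw [hfib, hid, mul_zero]

end GenThreeEndBridgeReal

end Summit.ABC.StewartYu

end
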